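import Summits.Ventures.PercRepro.K4LadderBridge
import Summits.Ventures.PercRepro.K4LadderLowerBridge
import Summits.Ventures.PercRepro.K4Layer6

/-!
# PercRepro — C-025 on `T_p(M(K₄) ⊕ U_{m,m})` at the layer `m = p + q − 6`: the matroid bridge (p9, gen 15; local draft)

The layer `m = p + q − 6` (corank `q + 0`) of the `K₄` family, every level `q ≥ 6`, every `p ≥ q + 2`: the
orbits with `k₁ + k₂ < 6` are inactive (`orbit_sum_U_inactive`), the others give `#U` and `#Y` as in `K4Layer6`,
so the profile sums of `K4Matroid` reduce the count to the arithmetic `k4_l6_base` (k4_l6_ineq), and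
**`rls_k4Ladder_layer6`** is C-025 on `T_p(M(K₄) ⊕ U_{p+q−6, p+q−6})` for every `q ≥ 6`, `p ≥ q + 2`.
Nothing here is about any window of S4.
-/

namespace PercRepro.K4Ladder

open Set Finset PercRepro.LineLadder PercRepro.K4Ladder

/-- **The layer-`6` inequality in profile form** (`q ≥ 6`, `p ≥ q + 2`, `m = p + q − 6`): the orbit sums with the
multiplicities of the profile table. -/
theorem k4_l6_ineq (p q : ℕ) (hq : 6 ≤ q) (hpq : q + 2 ≤ p) :
    phiK p q * ((0 + 6 * 0 + 19 * 0 + 12 * (if 3 ≤ q then (p + q - 6).choose (q - 3) else 0) + 19 * 0 + 6 * 0 + 0 : ℕ) : ℚ)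
      ≤ ((∑ a ∈ Ico (q + 1) p, (p + q - 6).choose a + 6 * ∑ a ∈ Ico q (p - 1), (p + q - 6).choose a
        + 19 * ∑ a ∈ Ico (q - 1) (p - 2), (p + q - 6).choose a
        + 12 * ∑ a ∈ Ico (q - 2) (p - 3), (p + q - 6).choose a
        + 19 * ∑ a ∈ Ico (q - 2) (p - 3), (p + q - 6).choose a
        + 6 * ∑ a ∈ Ico (q - 2) (p - 3), (p + q - 6).choose a
        + ∑ a ∈ Ico (q - 2) (p - 3), (p + q - 6).choose a : ℕ) : ℚ) := by
  obtain ⟨r, rfl⟩ : ∃ r, q = r + 6 := ⟨q - 6, by omega⟩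
  obtain ⟨s, rfl⟩ : ∃ s, p = r + s + 8 := ⟨p - r - 8, by omega⟩
  have h := k4_l6_base r s
  rw [if_pos (by omega : 3 ≤ r + 6)]
  rw [show r + s + 8 + (r + 6) - 6 = 2 * r + s + 8 by omega, show r + 6 - 3 = r + 3 by omega, show r + 6 + 1 = r + 7 by omega, show r + 6 - 1 = r + 5 by omega, show r + 6 - 2 = r + 4 by omega, show r + s + 8 - 1 = r + s + 7 by omega, show r + s + 8 - 2 = r + s + 6 by omega, show r + s + 8 - 3 = r + s + 5 by omega]
  have eU : (0 + 6 * 0 + 19 * 0 + 12 * (2 * r + s + 8).choose (r + 3) + 19 * 0 + 6 * 0 + 0 : ℕ)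
      = 12 * (2 * r + s + 8).choose (r + 3) := by ring
  have eY : (∑ a ∈ Ico (r + 7) (r + s + 8), (2 * r + s + 8).choose a
      + 6 * ∑ a ∈ Ico (r + 6) (r + s + 7), (2 * r + s + 8).choose a
      + 19 * ∑ a ∈ Ico (r + 5) (r + s + 6), (2 * r + s + 8).choose a
      + 12 * ∑ a ∈ Ico (r + 4) (r + s + 5), (2 * r + s + 8).choose a
      + 19 * ∑ a ∈ Ico (r + 4) (r + s + 5), (2 * r + s + 8).choose a
      + 6 * ∑ a ∈ Ico (r + 4) (r + s + 5), (2 * r + s + 8).choose a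
      + ∑ a ∈ Ico (r + 4) (r + s + 5), (2 * r + s + 8).choose a : ℕ)
      = ∑ a ∈ Ico (r + 7) (r + s + 8), (2 * r + s + 8).choose a
        + 6 * ∑ a ∈ Ico (r + 6) (r + s + 7), (2 * r + s + 8).choose a
        + 19 * ∑ a ∈ Ico (r + 5) (r + s + 6), (2 * r + s + 8).choose a
        + 38 * ∑ a ∈ Ico (r + 4) (r + s + 5), (2 * r + s + 8).choose a := by ring
  rw [eU, eY]
  exact h

variable {α : Type}

/-- **C-025 ON `T_p(M(K₄) ⊕ U_{m,m})` AT THE LAYER `m = p + q − 6`** (corank `q + 0`), every level `q ≥ 6`,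
every `p ≥ q + 2`. -/
theorem rls_k4Ladder_layer6 (e : Fin 6 ↪ α) {F : Set α} (hF : F.Finite)
    (hEF : Disjoint (K4.mapEmbedding e).E (Matroid.freeOn F).E) {p q : ℕ} (hFm : F.ncard = p + q - 6)
    (hq : 6 ≤ q) (hpq : q + 2 ≤ p) :
    @ThmN.RLS α (@PercRepro.Matroid.truncate α ((K4.mapEmbedding e).disjointSum (Matroid.freeOn F) hEF)
        (@blockFree_finite α _ (mapK4_finite e) F hF hEF) p)
      (@PercRepro.Matroid.truncate_finite α _ (@blockFree_finite α _ (mapK4_finite e) F hF hEF) p) p q := by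
  haveI := mapK4_finite e
  unfold ThmN.RLS
  rw [ncard_U_blockFree' (K4.mapEmbedding e) hF hEF p q, ncard_Y_blockFree' (K4.mapEmbedding e) hF hEF p q, hFm,
    finite_subsets_eq, Finset.sum_image (fun _ _ _ _ h => image_coe_injective e h),
    Finset.sum_image (fun _ _ _ _ h => image_coe_injective e h)]
  simp only [mapK4_eRk, mapK4_eRk_compl, ENat.toNat_coe]
  show phiK p q * ((∑ x : Finset (Fin 6), orbU p q (p + q - 6) (profile x) : ℕ) : ℚ)
    ≤ ((∑ x : Finset (Fin 6), orbY p q (p + q - 6) (profile x) : ℕ) : ℚ)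
  rw [sum_profile (orbU p q (p + q - 6)), sum_profile (orbY p q (p + q - 6))]
  simp only [orbU, orbY]
  have hqp : q < p := by omega
  rw [orbit_sum_U_inactive p q (p + q - 6) 0 3 hqp (by omega),
    orbit_sum_U_inactive p q (p + q - 6) 1 3 hqp (by omega),
    orbit_sum_U_inactive p q (p + q - 6) 2 3 hqp (by omega),
    orbit_sum_U p q (p + q - 6) 3 3 hqp (by omega),
    orbit_sum_U_inactive p q (p + q - 6) 3 2 hqp (by omega),
    orbit_sum_U_inactive p q (p + q - 6) 3 1 hqp (by omega),
    orbit_sum_U_inactive p q (p + q - 6) 3 0 hqp (by omega),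
    orbit_sum_Y p q (p + q - 6) 0, orbit_sum_Y p q (p + q - 6) 1, orbit_sum_Y p q (p + q - 6) 2, orbit_sum_Y p q (p + q - 6) 3]
  rw [show q + 1 - 0 = q + 1 by omega, show p - 0 = p by omega, show q + 1 - 1 = q by omega, show q + 1 - 2 = q - 1 by omega, show q + 1 - 3 = q - 2 by omega]
  exact k4_l6_ineq p q hq hpq

end PercRepro.K4Ladder
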